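import Literature.Analysis.FluidPDE.CheskidovTotalDissipationOfBlocks
import HarnessLib

/-!
# Cheskidov's total-dissipation family: the decomposition record (`cheskidov_total_dissipation_family_holds_of`)

Topic `Literature/Analysis/FluidPDE` (family `turb`). Decomposition (librarian `fact-decompose`,
2026-08-16) of the XL named fact `Literature.Analysis.FluidPDE.cheskidov_total_dissipation_family`
(`CheskidovTotalDissipation.lean`; Cheskidov, arXiv:2311.04182, §§3–4 and (6.2)–(6.5): viscosities
`ν_m → 0`, glued Alberti–Crippa–Mazzucato / Bruè–De Lellis drifts, the advected scalars and their
total dissipation anomaly, the inviscid profile and the convergence of the Navier–Stokes forces).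

Everything of the printed construction downstream of the kinematic building blocks is already
PROVED in the tree (`CheskidovTotalDissipationProofs.lean`: `…_of_acm_family`, with parabolic
well-posedness `Torus.exists_unique_isClassicalScalarTransportForcedOn_holds`;
`QuasiSelfSimilarMixing*.lean`: the scaling analysis `alberti_crippa_mazzucato_family_of_building_blocks`;
`QuasiSelfSimilarCompatibleBlocksProofs.lean`: `acm_building_blocks_of_compatible_blocks`), so the
single remaining printed input is the EXISTING named fact

* `acm_compatible_blocks` (`QuasiSelfSimilarCompatibleBlocks.lean`; Alberti–Crippa–Mazzucato,
  JAMS 32 (2019), §8.1 (a)–(e), §8.4 (a)–(c), §8.5, §8.6: the compatible block system of the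
  Peano snake; Bruè–De Lellis, CMP 400 (2023), §4.1 (i)–(iv)),

shared with the sibling facts `brue_deLellis_anomalous_dissipation` and `cheskidov_noAnomaly_family`.
The assembly `cheskidov_total_dissipation_family_holds_of` is the tree's
`cheskidov_total_dissipation_family_of_compatible_blocks`. No new fact; theorems only.

## References

* A. Cheskidov, *Dissipation anomaly and anomalous dissipation in incompressible fluid flows*,
  arXiv:2311.04182 (2023), §3 (3.2)–(3.13), §4 (4.2)–(4.13), (4.20), §6 (6.2)–(6.5). [Cheskidov2023]
* G. Alberti, G. Crippa, A. L. Mazzucato, *Exponential self-similar mixing by incompressible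
  flows*, J. Amer. Math. Soc. 32 (2019), §8. [AlbertiCrippaMazzucato2019]
* E. Bruè, C. De Lellis, Comm. Math. Phys. 400 (2023), Thm. 4.1, §4.1, §5. [BrueDeLellisCMP2023]
-/

namespace Literature.Analysis.FluidPDE

/-- **Cheskidov's total-dissipation family from the compatible block system of the Peano snake**
(the decomposition assembly of `cheskidov_total_dissipation_family`; the tree's
`cheskidov_total_dissipation_family_of_compatible_blocks`).
[cite: Cheskidov2023, §4 (4.2)–(4.13), (4.20) and §6 (6.2)–(6.5)] [cite: AlbertiCrippaMazzucato2019, §8.1, §8.4, §8.6] -/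
theorem cheskidov_total_dissipation_family_holds_of :
    acm_compatible_blocks → cheskidov_total_dissipation_family :=
  cheskidov_total_dissipation_family_of_compatible_blocks

end Literature.Analysis.FluidPDE
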